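import Literature.NumberTheory.Automorphic.UnitaryDepthZeroPieceOrbitalIntegral   -- ★ p845945 (this seat): §3 `ncard_fixedBy_rankStratum_eq_ncard_localNonsplitEquiv` (+ ★ p845609 `ncard_fixedBy_{glInt,unitary}_sep_eq_ncard`)
import Literature.NumberTheory.Automorphic.FixedCosetsLevelShift               -- ★ B-p10: `mem_glInt_and_level_iff_map_levelShift_le`, `map_eq_self_and_level_iff_map_levelShift_le`, `smul_mk_eq_of_level`
import HarnessLib

/-!
# ROW 0 — the residually TRIVIAL fixed cosets (`rank(red(g⁻¹γg) − 1) = 0`, i.e. `g⁻¹γg ≡ 1 mod 𝔪`) are the SHIFT-STABLE lattices: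
# `#{gK ∈ Fix_γ : red(g⁻¹γg) = 1} = #{Λ = Λ(g) : (1 + ϖ⁻¹(γ − 1))·Λ ⊆ Λ}` (in `GL_n(F)`, in `U(J)`, and on the one-place model of `U(H)(L⁺_v)`)

Topic `NumberTheory/Automorphic`; namespace `Literature.NumberTheory.Automorphic`.  THEOREMS ONLY (no definition, no instance, no notation, no named fact,
no `sorry`); generic `[Field F] [ValuativeRel F]` with a uniformizing element `ϖ` (★ `IsUniformizingElement`), any `n`.  Cell `pub/hodgecm-mathlib` (D-0151), crux
H413 = `stmt-HodgeConjecture-24833`; road «S3-tree» (architect A-p16 (g29)), brick T3′ (holder F0P3b-p01 (g11), DESIGN v2 §2 (P-1) row `ψ₀`), organ **«ROW-0 LATTICE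
FORM»** (A-p12 (g21); holder's 17:20:47Z (3) text): the `r = 0` twin of ★ `ncard_fixedBy_rankStratum_eq_ncard_free_of_deep` — the stratum count `n₀(t)` of ★
`classOrbitalIntegral_eq_mul_strata_three_of_deep` landed on the LATTICE set of ★ B-p10's level-shift law, ready for ★ CAYLEY (`𝒪[(t_w − 1)∕ϖ] = 𝒪[Y]`) ∘ ★
ORDER-STABILITY ∘ ★ Flicker counts at the shifted exponents.  HONEST LABEL: HC_CM is proved only modulo the 2 remaining named inputs (hLiu418 24832, h413 24833)
until rung 0 closes; nothing printed is asserted here (linear algebra over a valuation ring + coset bookkeeping).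

THE MATHEMATICS.  For `k ∈ GL_n(𝒪)`: `rank(k̄ − 1) = 0 ⟺ k̄ = 1 ⟺ |(k − 1)_{ij}| < 1 ∀ i j ⟺ |(k − 1)_{ij}| ≤ |ϖ|` (`ϖ` a uniformizing element: `𝔪 = ϖ𝒪`); and for a
coset `gK` fixed by `γ`, `k = g⁻¹γg`, ★ B-p10's law says `(γΛ(g) = Λ(g) ∧ g⁻¹γg ≡ 1 mod ϖ) ⟺ (1 + ϖ⁻¹(γ − 1))·Λ(g) ⊆ Λ(g)` (the shift-stable lattices; the fixedness
conjunct is implied).  Hence (§2) `#{gK ∈ Fix_γ : rank(red(g⁻¹γg) − 1) = 0} = #{Λ = Λ(g) : (1 + ϖ⁻¹(γ−1))Λ ⊆ Λ}`, (§3) the same inside `U(J)` with `Λ = Λ(u)`, `u ∈ U`, and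
(§4) at a non-split CM place, `n₀(t)` of the value formula equals that lattice count on the one-place model `U(σ_w, H_w)(L_w)` at `t_w` (★ FILE 3 §3 transport).
No deepness hypothesis is needed for row 0.

* §1 `rank_eq_zero_iff_eq_zero`, `redMat_sub_eq_zero_iff_forall_valuation_lt_one`, **`rank_redMat_sub_one_eq_zero_iff_forall_valuation_le`**.
* §2 **`ncard_fixedBy_glInt_rank_zero_eq_ncard_levelShift`**.   §3 **`ncard_fixedBy_unitary_rank_zero_eq_ncard_levelShift`**.
* §4 **`ncard_fixedBy_rankStratum_zero_eq_ncard_levelShift`** (CM place, one-place model).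

## References
* [Kottwitz1986] R. E. Kottwitz, *Base change for unit elements of Hecke algebras*, Compositio Math. 60 (1986): §3 (fixed cosets ↔ stable lattices; level).
* [Rogawski1990] J. D. Rogawski, *Automorphic Representations of Unitary Groups in Three Variables* (1990): §4.9 p. 54, Prop. 4.9.1 (b) p. 55.
* [Serre1980Trees] J.-P. Serre, *Trees* (1980): Ch. II §1.1–1.2 (congruence level of a stabiliser).
* [PlatonovRapinchuk1994] V. Platonov, A. Rapinchuk, *Algebraic Groups and Number Theory* (1994): §5.1.
-/

set_option autoImplicit false

noncomputable section

open scoped ValuativeRel Matrix MatrixGroups Polynomial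
open ValuativeRel Set NumberField IsDedekindDomain

namespace Literature.NumberTheory.Automorphic

open Literature.NumberTheory.Automorphic.IntegralReduction Literature.NumberTheory.Automorphic.UnitaryGroup

/-! ## §1 `rank(red k − 1) = 0 ⟺ k ≡ 1 (mod ϖ)` for `k ∈ GL_n(𝒪)` -/

section GLn

variable {F : Type*} [Field F] [ValuativeRel F] {n : ℕ}

/-- Over a field, a matrix has rank `0` iff it is `0`. [cite: Kottwitz1986, §3] -/
theorem rank_eq_zero_iff_eq_zero {𝕜 : Type*} [Field 𝕜] {m : ℕ} (M : Matrix (Fin m) (Fin m) 𝕜) : M.rank = 0 ↔ M = 0 := by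
  rw [Matrix.rank, Submodule.finrank_eq_zero, LinearMap.range_eq_bot]
  constructor
  · intro h
    have h' : Matrix.toLin' M = 0 := h
    exact (LinearEquiv.map_eq_zero_iff Matrix.toLin').1 h'
  · rintro rfl
    exact Matrix.mulVecLin_zero

/-- For an integral matrix `M`: `red M = 0 ↔ |M_{ij}| < 1` for all `i, j`. [cite: Kottwitz1986, §3] -/
theorem redMat_eq_zero_iff_forall_valuation_lt_one {M : Matrix (Fin n) (Fin n) F} (hM : ValBound 1 M) :
    redMat M = 0 ↔ ∀ i j, valuation F (M i j) < 1 := by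
  constructor
  · intro h i j
    by_contra hlt
    have h1 : valuation F (M i j) = 1 := le_antisymm (hM i j) (not_lt.1 hlt)
    have h2 := red_ne_zero_of_valuation_eq_one h1
    exact h2 (by have := congr_fun (congr_fun h i) j; rwa [redMat, Matrix.map_apply] at this)
  · intro h
    ext i j
    rw [redMat, Matrix.map_apply, Matrix.zero_apply]
    by_contra hne
    exact (h i j).ne (valuation_eq_one_of_red_ne_zero ((Valuation.mem_integer_iff _ _).2 (hM i j)) hne)

/-- **ROW 0 IN `GL_n(𝒪)`: `rank(red k − 1) = 0 ⟺ k ≡ 1 (mod ϖ)`**, i.e. `|(k − 1)_{ij}| ≤ |ϖ|` for all `i, j` (the level-`1` condition of ★ B-p10's law).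
[cite: Kottwitz1986, §3] [cite: Serre1980Trees, Ch. II §1.1–1.2] -/
theorem rank_redMat_sub_one_eq_zero_iff_forall_valuation_le {ϖ : F} (hϖ : IsUniformizingElement ϖ) {k : GL (Fin n) F} (hk : k ∈ glInt n F) :
    (redMat (k : Matrix (Fin n) (Fin n) F) - 1).rank = 0 ↔ ∀ i j, valuation F (((k : Matrix (Fin n) (Fin n) F) - 1) i j) ≤ valuation F ϖ := by
  have hkv : ValBound 1 (k : Matrix (Fin n) (Fin n) F) := fun i j => (Valuation.mem_integer_iff _ _).1 (((mem_glInt_iff _).1 hk).1 i j)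
  have hsub : redMat (k : Matrix (Fin n) (Fin n) F) - 1 = redMat ((k : Matrix (Fin n) (Fin n) F) - 1) := by
    rw [redMat_sub hkv valBound_one, redMat_one]
  rw [hsub, rank_eq_zero_iff_eq_zero, redMat_eq_zero_iff_forall_valuation_lt_one (hkv.sub valBound_one)]
  -- with a uniformizing element `ϖ` (`𝔪 = ϖ𝒪`): `|x| < 1 ↔ |x| ≤ |ϖ|` (cf. ★ `Zelevinsky1980.valuation_lt_one_iff_le_valuation`, not imported here)
  have hlt : ∀ x : F, valuation F x < 1 ↔ valuation F x ≤ valuation F ϖ := fun x =>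
    ⟨fun hx => by
      obtain ⟨y, hy, rfl⟩ := hϖ.exists_eq_mul ((Valuation.mem_integer_iff _ _).2 hx.le) hx
      rw [map_mul]
      exact mul_le_of_le_one_right' ((Valuation.mem_integer_iff _ _).1 hy),
     fun hx => hx.trans_lt hϖ.valuation_lt_one⟩
  exact forall_congr' fun i => forall_congr' fun j => hlt _

end GLn

/-! ## §2 `GL_n(F) ⊃ GL_n(𝒪)`: the residually trivial fixed cosets are the shift-stable lattices -/

section GLnCount

variable {F : Type*} [Field F] [ValuativeRel F] {n : ℕ}

/-- **ROW 0 AS A LATTICE COUNT**: `#{gK ∈ Fix_γ(GL_n(F) ⧸ GL_n(𝒪)) : rank(red(g⁻¹γg) − 1) = 0} = #{Λ = Λ(g) : (1 + ϖ⁻¹(γ − 1))·Λ ⊆ Λ}` — the level-`1` fixed cosets are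
the lattices stable under the shifted endomorphism (★ B-p10 `map_eq_self_and_level_iff_map_levelShift_le`; the fixedness conjunct is implied by shift-stability).
[cite: Kottwitz1986, §3] [cite: Rogawski1990, §4.9 p. 54] -/
theorem ncard_fixedBy_glInt_rank_zero_eq_ncard_levelShift {ϖ : F} (hϖ : IsUniformizingElement ϖ) (γ : GL (Fin n) F) :
    {q : GL (Fin n) F ⧸ glInt n F | q ∈ MulAction.fixedBy (GL (Fin n) F ⧸ glInt n F) γ ∧
        (redMat (((q.out)⁻¹ * γ * q.out : GL (Fin n) F) : Matrix (Fin n) (Fin n) F) - 1).rank = 0}.ncard =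
      {Λ : Submodule 𝒪[F] (Fin n → F) |
        (∃ g : GL (Fin n) F, Λ = Submodule.span 𝒪[F] (Set.range ((g : Matrix (Fin n) (Fin n) F))ᵀ)) ∧
          Λ.map ((Matrix.toLin' (1 + ϖ⁻¹ • ((γ : Matrix (Fin n) (Fin n) F) - 1))).restrictScalars 𝒪[F]) ≤ Λ}.ncard := by
  have h1 := ncard_fixedBy_glInt_sep_eq_ncard γ
    (fun Λ => Λ.map ((Matrix.toLin' (1 + ϖ⁻¹ • ((γ : Matrix (Fin n) (Fin n) F) - 1))).restrictScalars 𝒪[F]) ≤ Λ)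
  -- the rank-`0` stratum is the level-`1` stratum, i.e. the shift-stable cosets
  have h2 : {q : GL (Fin n) F ⧸ glInt n F | q ∈ MulAction.fixedBy (GL (Fin n) F ⧸ glInt n F) γ ∧
        (redMat (((q.out)⁻¹ * γ * q.out : GL (Fin n) F) : Matrix (Fin n) (Fin n) F) - 1).rank = 0} =
      {q : GL (Fin n) F ⧸ glInt n F | q ∈ MulAction.fixedBy (GL (Fin n) F ⧸ glInt n F) γ ∧
        (Submodule.span 𝒪[F] (Set.range (((q.out : GL (Fin n) F) : Matrix (Fin n) (Fin n) F))ᵀ)).map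
          ((Matrix.toLin' (1 + ϖ⁻¹ • ((γ : Matrix (Fin n) (Fin n) F) - 1))).restrictScalars 𝒪[F]) ≤
            Submodule.span 𝒪[F] (Set.range (((q.out : GL (Fin n) F) : Matrix (Fin n) (Fin n) F))ᵀ)} := by
    ext q
    simp only [Set.mem_setOf_eq]
    refine ⟨fun ⟨hq, hr⟩ => ⟨hq, ?_⟩, fun ⟨hq, hP⟩ => ⟨hq, ?_⟩⟩
    · have hk := out_inv_mul_mul_out_mem_glInt_of_mem_fixedBy γ hq
      exact (mem_glInt_and_level_iff_map_levelShift_le hϖ.ne_zero hϖ.valuation_lt_one γ q.out).1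
        ⟨hk, (rank_redMat_sub_one_eq_zero_iff_forall_valuation_le hϖ hk).1 hr⟩
    · have hk := out_inv_mul_mul_out_mem_glInt_of_mem_fixedBy γ hq
      exact (rank_redMat_sub_one_eq_zero_iff_forall_valuation_le hϖ hk).2
        ((mem_glInt_and_level_iff_map_levelShift_le hϖ.ne_zero hϖ.valuation_lt_one γ q.out).2 hP).2
  -- the fixedness conjunct on the lattice side is implied by shift-stability
  have h3 : {Λ : Submodule 𝒪[F] (Fin n → F) |
        (∃ g : GL (Fin n) F, Λ = Submodule.span 𝒪[F] (Set.range ((g : Matrix (Fin n) (Fin n) F))ᵀ)) ∧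
          Λ.map ((Matrix.toLin' (γ : Matrix (Fin n) (Fin n) F)).restrictScalars 𝒪[F]) = Λ ∧
            Λ.map ((Matrix.toLin' (1 + ϖ⁻¹ • ((γ : Matrix (Fin n) (Fin n) F) - 1))).restrictScalars 𝒪[F]) ≤ Λ} =
      {Λ : Submodule 𝒪[F] (Fin n → F) |
        (∃ g : GL (Fin n) F, Λ = Submodule.span 𝒪[F] (Set.range ((g : Matrix (Fin n) (Fin n) F))ᵀ)) ∧
          Λ.map ((Matrix.toLin' (1 + ϖ⁻¹ • ((γ : Matrix (Fin n) (Fin n) F) - 1))).restrictScalars 𝒪[F]) ≤ Λ} := by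
    ext Λ
    simp only [Set.mem_setOf_eq]
    refine ⟨fun ⟨hg, _, hP⟩ => ⟨hg, hP⟩, fun ⟨hg, hP⟩ => ⟨hg, ?_, hP⟩⟩
    obtain ⟨g, rfl⟩ := hg
    exact ((map_eq_self_and_level_iff_map_levelShift_le hϖ.ne_zero hϖ.valuation_lt_one γ g).2 hP).1
  rw [h2, h1, h3]

end GLnCount

/-! ## §3 Inside the unitary group `U(J) ≤ GL_n(E)` -/

section Unitary

variable {E : Type*} [Field E] [ValuativeRel E] {n : ℕ} (σ : E →+* E) (J : GL (Fin n) E)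

/-- **ROW 0 INSIDE `U(J)`**: `#{uK_U ∈ Fix_γ(U ⧸ K_U) : rank(red(u⁻¹γu) − 1) = 0} = #{Λ = Λ(u), u ∈ U : (1 + ϖ⁻¹(γ − 1))·Λ ⊆ Λ}`.
[cite: Kottwitz1986, §3] [cite: Rogawski1990, §4.9 Prop. 4.9.1 (b) p. 55] -/
theorem ncard_fixedBy_unitary_rank_zero_eq_ncard_levelShift {ϖ : E} (hϖ : IsUniformizingElement ϖ)
    (γ : ↥(unitaryGroupOfForm σ (J : Matrix (Fin n) (Fin n) E))) :
    {q : ↥(unitaryGroupOfForm σ (J : Matrix (Fin n) (Fin n) E)) ⧸ (glInt n E).subgroupOf (unitaryGroupOfForm σ (J : Matrix (Fin n) (Fin n) E)) |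
        q ∈ MulAction.fixedBy (↥(unitaryGroupOfForm σ (J : Matrix (Fin n) (Fin n) E)) ⧸ (glInt n E).subgroupOf (unitaryGroupOfForm σ (J : Matrix (Fin n) (Fin n) E))) γ ∧
          (redMat ((((q.out)⁻¹ * γ * q.out : ↥(unitaryGroupOfForm σ (J : Matrix (Fin n) (Fin n) E))) : GL (Fin n) E) : Matrix (Fin n) (Fin n) E) - 1).rank = 0}.ncard =
      {Λ : Submodule 𝒪[E] (Fin n → E) |
        (∃ u ∈ unitaryGroupOfForm σ (J : Matrix (Fin n) (Fin n) E), Λ = Submodule.span 𝒪[E] (Set.range ((u : Matrix (Fin n) (Fin n) E))ᵀ)) ∧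
          Λ.map ((Matrix.toLin' (1 + ϖ⁻¹ • ((((γ : GL (Fin n) E)) : Matrix (Fin n) (Fin n) E) - 1))).restrictScalars 𝒪[E]) ≤ Λ}.ncard := by
  have h1 := ncard_fixedBy_unitary_sep_eq_ncard σ J γ
    (fun Λ => Λ.map ((Matrix.toLin' (1 + ϖ⁻¹ • ((((γ : GL (Fin n) E)) : Matrix (Fin n) (Fin n) E) - 1))).restrictScalars 𝒪[E]) ≤ Λ)
  have h2 : {q : ↥(unitaryGroupOfForm σ (J : Matrix (Fin n) (Fin n) E)) ⧸ (glInt n E).subgroupOf (unitaryGroupOfForm σ (J : Matrix (Fin n) (Fin n) E)) |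
        q ∈ MulAction.fixedBy (↥(unitaryGroupOfForm σ (J : Matrix (Fin n) (Fin n) E)) ⧸ (glInt n E).subgroupOf (unitaryGroupOfForm σ (J : Matrix (Fin n) (Fin n) E))) γ ∧
          (redMat ((((q.out)⁻¹ * γ * q.out : ↥(unitaryGroupOfForm σ (J : Matrix (Fin n) (Fin n) E))) : GL (Fin n) E) : Matrix (Fin n) (Fin n) E) - 1).rank = 0} =
      {q : ↥(unitaryGroupOfForm σ (J : Matrix (Fin n) (Fin n) E)) ⧸ (glInt n E).subgroupOf (unitaryGroupOfForm σ (J : Matrix (Fin n) (Fin n) E)) |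
        q ∈ MulAction.fixedBy (↥(unitaryGroupOfForm σ (J : Matrix (Fin n) (Fin n) E)) ⧸ (glInt n E).subgroupOf (unitaryGroupOfForm σ (J : Matrix (Fin n) (Fin n) E))) γ ∧
          (Submodule.span 𝒪[E] (Set.range ((((q.out : ↥(unitaryGroupOfForm σ (J : Matrix (Fin n) (Fin n) E))) : GL (Fin n) E) : Matrix (Fin n) (Fin n) E))ᵀ)).map
            ((Matrix.toLin' (1 + ϖ⁻¹ • ((((γ : GL (Fin n) E)) : Matrix (Fin n) (Fin n) E) - 1))).restrictScalars 𝒪[E]) ≤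
              Submodule.span 𝒪[E] (Set.range ((((q.out : ↥(unitaryGroupOfForm σ (J : Matrix (Fin n) (Fin n) E))) : GL (Fin n) E) : Matrix (Fin n) (Fin n) E))ᵀ)} := by
    ext q
    simp only [Set.mem_setOf_eq]
    refine ⟨fun ⟨hq, hr⟩ => ⟨hq, ?_⟩, fun ⟨hq, hP⟩ => ⟨hq, ?_⟩⟩
    · have hk := coe_out_inv_mul_mul_out_mem_glInt_of_mem_fixedBy σ J γ hq
      rw [Subgroup.coe_mul, Subgroup.coe_mul, Subgroup.coe_inv] at hk hr
      exact (mem_glInt_and_level_iff_map_levelShift_le hϖ.ne_zero hϖ.valuation_lt_one (γ : GL (Fin n) E) _).1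
        ⟨hk, (rank_redMat_sub_one_eq_zero_iff_forall_valuation_le hϖ hk).1 hr⟩
    · have hk := coe_out_inv_mul_mul_out_mem_glInt_of_mem_fixedBy σ J γ hq
      rw [Subgroup.coe_mul, Subgroup.coe_mul, Subgroup.coe_inv] at hk ⊢
      exact (rank_redMat_sub_one_eq_zero_iff_forall_valuation_le hϖ hk).2
        ((mem_glInt_and_level_iff_map_levelShift_le hϖ.ne_zero hϖ.valuation_lt_one (γ : GL (Fin n) E) _).2 hP).2
  have h3 : {Λ : Submodule 𝒪[E] (Fin n → E) |
        (∃ u ∈ unitaryGroupOfForm σ (J : Matrix (Fin n) (Fin n) E), Λ = Submodule.span 𝒪[E] (Set.range ((u : Matrix (Fin n) (Fin n) E))ᵀ)) ∧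
          Λ.map ((Matrix.toLin' (((γ : GL (Fin n) E) : Matrix (Fin n) (Fin n) E))).restrictScalars 𝒪[E]) = Λ ∧
            Λ.map ((Matrix.toLin' (1 + ϖ⁻¹ • ((((γ : GL (Fin n) E)) : Matrix (Fin n) (Fin n) E) - 1))).restrictScalars 𝒪[E]) ≤ Λ} =
      {Λ : Submodule 𝒪[E] (Fin n → E) |
        (∃ u ∈ unitaryGroupOfForm σ (J : Matrix (Fin n) (Fin n) E), Λ = Submodule.span 𝒪[E] (Set.range ((u : Matrix (Fin n) (Fin n) E))ᵀ)) ∧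
          Λ.map ((Matrix.toLin' (1 + ϖ⁻¹ • ((((γ : GL (Fin n) E)) : Matrix (Fin n) (Fin n) E) - 1))).restrictScalars 𝒪[E]) ≤ Λ} := by
    ext Λ
    simp only [Set.mem_setOf_eq]
    refine ⟨fun ⟨hu, _, hP⟩ => ⟨hu, hP⟩, fun ⟨hu, hP⟩ => ⟨hu, ?_, hP⟩⟩
    obtain ⟨u, -, rfl⟩ := hu
    exact ((map_eq_self_and_level_iff_map_levelShift_le hϖ.ne_zero hϖ.valuation_lt_one (γ : GL (Fin n) E) u).2 hP).1
  rw [h2, h1, h3]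

end Unitary

/-! ## §4 The CM place: `n₀(t)` on the one-place model -/

section CM

variable (L : Type) [Field L] [NumberField L] [IsCMField L] (N : ℕ) (H : Matrix (Fin N) (Fin N) L) (v : HeightOneSpectrum (𝓞 ↥(maximalRealSubfield L)))
  (w : UnitaryGroup.PlacesOver L v) (hw : IsCMField.complexConj L • w.1 = w.1)

include hw in
/-- **ROW 0 AT A NON-SPLIT CM PLACE**: `n₀(t) = #{q ∈ Fix_t(U(H)(L⁺_v) ⧸ U(H)(𝒪_v)) : rank(red((q.out⁻¹ t q.out)_w) − 1) = 0} = #{Λ = Λ(u), u ∈ U(σ_w, H_w)(L_w) :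
(1 + ϖ_w⁻¹(t_w − 1))·Λ ⊆ Λ}` — the shift-stable (self-dual) lattices on the one-place model; with ★ CAYLEY (`𝒪_w[(t_w − 1)∕ϖ_w] = 𝒪_w[Y]`) and ★ ORDER-STABILITY this is
`#Fix_Y`, a ★ Flicker unit count at the shifted exponents. (★ FILE 3 §3 transport at `r = 0` ∘ §3.) [cite: Kottwitz1986, §3] [cite: Rogawski1990, §4.9 Prop. 4.9.1 (b) p. 55]
[cite: PlatonovRapinchuk1994, §5.1] -/
theorem ncard_fixedBy_rankStratum_zero_eq_ncard_levelShift (hJw : IsUnit (placeForm H w.1)) {ϖ : w.1.adicCompletion L} (hϖ : IsUniformizingElement ϖ)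
    (t : (cmDatum L N H).Local v) :
    {q : (cmDatum L N H).Local v ⧸ cmLocalIntegralLevel L N H v |
        q ∈ MulAction.fixedBy ((cmDatum L N H).Local v ⧸ cmLocalIntegralLevel L N H v) t ∧
          (redMat ((((q.out⁻¹ * t * q.out : (cmDatum L N H).Local v)).val : GL (Fin N) (LocalRing L v)).val.map
            (Pi.evalRingHom (fun w' : UnitaryGroup.PlacesOver L v => w'.1.adicCompletion L) w)) - 1).rank = 0}.ncard =
      {Λ : Submodule 𝒪[w.1.adicCompletion L] (Fin N → w.1.adicCompletion L) |
        (∃ u ∈ unitaryGroupOfForm (galAdicCompletionMap (L := L) (IsCMField.complexConj L) hw) (placeForm H w.1),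
            Λ = Submodule.span 𝒪[w.1.adicCompletion L] (Set.range ((u : Matrix (Fin N) (Fin N) (w.1.adicCompletion L)))ᵀ)) ∧
          Λ.map ((Matrix.toLin' (1 + ϖ⁻¹ • ((((localNonsplitEquiv (IsCMField.complexConj L) H (IsCMField.complexConj_ne_one L) w hw t :
              ↥(unitaryGroupOfForm (galAdicCompletionMap (L := L) (IsCMField.complexConj L) hw) (placeForm H w.1))) :
                GL (Fin N) (w.1.adicCompletion L)) : Matrix (Fin N) (Fin N) (w.1.adicCompletion L)) - 1))).restrictScalars 𝒪[w.1.adicCompletion L]) ≤ Λ}.ncard := by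
  rw [ncard_fixedBy_rankStratum_eq_ncard_localNonsplitEquiv L N H v w hw t 0]
  exact ncard_fixedBy_unitary_rank_zero_eq_ncard_levelShift (galAdicCompletionMap (L := L) (IsCMField.complexConj L) hw) hJw.unit hϖ
    (localNonsplitEquiv (IsCMField.complexConj L) H (IsCMField.complexConj_ne_one L) w hw t)

end CM

end Literature.NumberTheory.Automorphic

end
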